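import Summits.QuantumFields.YangMills.Theorems.FemtoCurvatureSkewness.Negative.WeakCoupling
import Summits.QuantumFields.YangMills.Theorems.LangevinControlUVFemtoCurvatureSkewnessEventualNonvanishing
import Summits.QuantumFields.YangMills.Theorems.LangevinControlUVFemtoCurvatureSkewnessImpliesC
import Summits.QuantumFields.YangMills.Theorems.LangevinControlUVLatticeGapInUVUnitsRulerRigidity

/-!
# `FemtoCurvatureSkewnessC` — negative-side support: what the OUTPUT continuity token carries, the shield, and the exact
# kill criterion (zeros in physically shrinking boxes, in ANY continuous package ruler)

Support file for crux `stmt-QuantumFields-16205` (`LangevinControlUV.FemtoCurvatureSkewnessC`, rank 4 — the ∃-bundled,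
continuous-units repair R1∘C′ of `FemtoCurvatureSkewness` 9365), extracted from the standing disprover's work file
`Cruxes/FemtoCurvatureSkewnessC/Disproof.lean` (cdisprove gen 1).  Theorems only, no `sorry`, nothing posited; vocabulary is the
LANDED negative-side toolkit (`Theorems/FemtoCurvatureSkewness/Negative/*`: `kappa3`, `TwoPointPackage`, `SkewnessPackage`,
`eventually_kappa3_ne_zero`, `level_mem_window`), the landed R1 ⟺ eventual-non-vanishing equivalence of line `coupling-cubic-response`
(`exists_package_and_skewness_of_eventually_ne_zero`), the landed unbundling `femtoCurvatureSkewnessC_iff`, and the landed ruler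
rigidity of continuous package maps (`LatticeGapInUVUnits.OneRuler.rulerRigidity_continuous`).

The crux reads `∀ G simple, ∀ r, (∃ a, Continuous a ∧ TwoPointPackage r a) → ∃ a, Continuous a ∧ TwoPointPackage r a ∧ SkewnessPackage r a`.

* `droppingOutputContinuity_iff_eventual` — **LOAD-BEARING: the token `Continuous a` on the OUTPUT map.**  Delete it (keep it in
  the hypothesis) and the crux becomes EQUIVALENT to "whenever a continuous package map exists, `κ₃(L, β, n) ≠ 0` for all large `β`
  on every FIXED torus `L ≥ 8n`" — a statement with no unit map, no relation between volume and coupling, no RG chain: fixed-lattice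
  weak-coupling semiclassics of ONE torus at a time.  The crux implies this weakening (`eventual_of_cruxC`), which is therefore its
  a-free residue (the part no choice of output map can soften).
* `chain_lower_of_continuous` — **what the token re-imposes**: a skewness package on a CONTINUOUS positive unit map `a → 0` gives,
  for every small physical size `s`, ONE constant `γ(s) > 0` with `γ(s) ≤ n¹² |κ₃(L, β, n)|` at EVERY admissible `(L, β)` on the
  level `n · a(β) = s` — and every resolution `n ≥ 1` IS realised on that level at a later coupling (intermediate values), with
  the box `L = 8n` admissible.  Uniformity in `n → ∞` at fixed physical geometry: the femto continuum limit of the plaquette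
  three-point function is bounded away from zero.  This is the ultraviolet content of R1∘C′.
* `refutationC_needs_twoPointC_witness` — **the shield**: any refutation exhibits `(G, r, a₀)` with `a₀` CONTINUOUS carrying the
  two-point package — an instance of the tier-deciding crux `FemtoCurvatureTwoPointC` (16204), not constructible in the tree.
* `not_cruxC_of_frequently_zero` — kill criterion I (a-free): such a witness plus ONE fixed torus on which `β ↦ κ₃(L, β, n)`
  vanishes at arbitrarily large `β`.
* `not_cruxC_of_zeros_in_shrinking_boxes` — **kill criterion II, the exact exposure left by the ∃-bundling**: such a witness
  `a₀` plus exact zeros `κ₃(L_k, β_k, n_k) = 0` above every coupling inside boxes of VANISHING physical size `L_k · a₀(β_k) → 0`.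
  By ruler rigidity every continuous package map the crux could answer with is `≤ K · a₀` eventually, so those zeros are
  admissible for its window whatever `β₁, ℓ₁` are.  Zeros at physical size bounded below — the infrared sign question that makes
  the typed `∀ a` item false modulo uniformities (`FemtoCurvatureSkewness_false_of_UniformZeros`) — never qualify: the repair did
  its job, and what remains is asymptotic freedom of the three-point function (tree sign `+`, landed `PerpPropagatorPos`).
-/

set_option autoImplicit false

noncomputable section

namespace Summit.QuantumFields.YangMills.Theorems.FemtoCurvatureSkewnessC.Negative

open MeasureTheory Filter Topology
open Literature.MathematicalPhysics.QuantumFieldTheory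
open Summit.QuantumFields.YangMills.Theses.LangevinControlUV (FemtoCurvatureSkewnessC)
open Summit.QuantumFields.YangMills.Theorems.FemtoCurvatureSkewness.Negative
open Summit.QuantumFields.YangMills.Theorems.FemtoCurvatureSkewness (femtoCurvatureSkewnessC_iff)
open Summit.QuantumFields.YangMills.Cruxes.FemtoCurvatureSkewness.CouplingCubicResponse
  (exists_package_and_skewness_of_eventually_ne_zero)
open Summit.QuantumFields.YangMills.Theorems.LatticeGapInUVUnits.OneRuler (rulerRigidity_continuous)

/-! ## §1 The output continuity token is load-bearing: without it, only fixed-torus eventual non-vanishing is left -/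

/-- **Dropping `Continuous` from the OUTPUT map leaves exactly fixed-torus eventual non-vanishing.**  The crux with the token
deleted from its conclusion (left-hand side) is EQUIVALENT to: for every compact simple `G` and every `r` admitting a continuous
package map, `κ₃(L, β, n) ≠ 0` for all sufficiently large `β` on every torus `L ≥ 8n ≥ 8` (right-hand side).  (→) is the landed
`eventually_kappa3_ne_zero`; (←) is the landed wild-map construction `exists_package_and_skewness_of_eventually_ne_zero` — the
map it returns is choice-constructed with singleton level sets, not even measurable: the ∃-bundled conclusion has ultraviolet
content ONLY through the continuity of the map it names. -/
theorem droppingOutputContinuity_iff_eventual :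
    (∀ (G : Type) [Group G] [TopologicalSpace G] [IsTopologicalGroup G] [CompactSpace G],
      IsCompactSimpleLieGroup G →
        letI : MeasurableSpace G := borel G
        haveI : BorelSpace G := ⟨rfl⟩
        ∀ (r : LatticeRep G), (∃ a : ℝ → ℝ, Continuous a ∧ TwoPointPackage r a) →
          ∃ a : ℝ → ℝ, TwoPointPackage r a ∧ SkewnessPackage r a) ↔
    ∀ (G : Type) [Group G] [TopologicalSpace G] [IsTopologicalGroup G] [CompactSpace G],
      IsCompactSimpleLieGroup G →
        letI : MeasurableSpace G := borel G
        haveI : BorelSpace G := ⟨rfl⟩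
        ∀ (r : LatticeRep G), (∃ a : ℝ → ℝ, Continuous a ∧ TwoPointPackage r a) →
          ∀ (L : ℕ) [NeZero L] (n : ℕ), 1 ≤ n → 8 * n ≤ L → ∀ᶠ β in atTop, kappa3 r L β n ≠ 0 := by
  constructor
  · intro h G _ _ _ _ hG
    letI : MeasurableSpace G := borel G
    haveI : BorelSpace G := ⟨rfl⟩
    intro r hex L _ n hn h8
    obtain ⟨a, hP, hS⟩ := h G hG r hex
    obtain ⟨Γ, β₀, ℓ₀, c, C, -, -, ha, ha0, -⟩ := id hP
    exact eventually_kappa3_ne_zero r ha ha0 hS L n hn h8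
  · intro h G _ _ _ _ hG
    letI : MeasurableSpace G := borel G
    haveI : BorelSpace G := ⟨rfl⟩
    intro r hex
    obtain ⟨a₀, -, h₀⟩ := id hex
    obtain ⟨a, -, hP, hS⟩ :=
      exists_package_and_skewness_of_eventually_ne_zero r h₀ (fun L _ n hn h8 => h G hG r hex L n hn h8)
    exact ⟨a, hP, hS⟩

/-- **The a-free residue of the crux**: `FemtoCurvatureSkewnessC` implies fixed-torus eventual non-vanishing of `κ₃` for every
compact simple `G` and every `r` with a continuous package map (forget the output token, then `droppingOutputContinuity_iff_eventual`). -/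
theorem eventual_of_cruxC (h : FemtoCurvatureSkewnessC) :
    ∀ (G : Type) [Group G] [TopologicalSpace G] [IsTopologicalGroup G] [CompactSpace G],
      IsCompactSimpleLieGroup G →
        letI : MeasurableSpace G := borel G
        haveI : BorelSpace G := ⟨rfl⟩
        ∀ (r : LatticeRep G), (∃ a : ℝ → ℝ, Continuous a ∧ TwoPointPackage r a) →
          ∀ (L : ℕ) [NeZero L] (n : ℕ), 1 ≤ n → 8 * n ≤ L → ∀ᶠ β in atTop, kappa3 r L β n ≠ 0 := by
  refine droppingOutputContinuity_iff_eventual.1 fun G _ _ _ _ hG => ?_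
  letI : MeasurableSpace G := borel G
  haveI : BorelSpace G := ⟨rfl⟩
  intro r hex
  obtain ⟨a, -, hP, hS⟩ := femtoCurvatureSkewnessC_iff.1 h G hG r hex
  exact ⟨a, hP, hS⟩

/-! ## §2 What the output continuity re-imposes: a uniform lower bound along every RG chain -/

section Chain

variable {G : Type} [Group G] [TopologicalSpace G] [IsTopologicalGroup G] [CompactSpace G]
  [MeasurableSpace G] [BorelSpace G]

omit [Group G] [TopologicalSpace G] [IsTopologicalGroup G] [CompactSpace G] [MeasurableSpace G] [BorelSpace G] in
/-- Intermediate values of a continuous unit map: every level `t ∈ (0, a β)` is attained at a LATER coupling (local copy of the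
sibling work file's `exists_later_level`). -/
theorem exists_later_level' {a : ℝ → ℝ} (hcont : Continuous a) (hat : Tendsto a atTop (𝓝 0)) (β : ℝ) {t : ℝ}
    (ht0 : 0 < t) (ht : t < a β) : ∃ β' : ℝ, β < β' ∧ a β' = t := by
  obtain ⟨B, hBt, hβB⟩ := ((hat.eventually (Iio_mem_nhds ht0)).and (eventually_gt_atTop β)).exists
  obtain ⟨x, hx, hxt⟩ :=
    intermediate_value_Icc' hβB.le hcont.continuousOn ⟨(le_of_lt hBt), ht.le⟩
  refine ⟨x, lt_of_le_of_ne hx.1 ?_, hxt⟩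
  rintro rfl
  exact absurd hxt (ne_of_gt ht)

/-- **What `Continuous a` re-imposes: ONE constant per physical size, uniformly along the RG chain.**  If a CONTINUOUS positive
unit map `a → 0` carries the skewness package then there are `β₁`, `ℓ₁` and `ℓ > 0` (`8ℓ ≤ ℓ₁`) such that for every physical size
`0 < s ≤ ℓ` one constant `γ(s) > 0` satisfies: for EVERY resolution `n ≥ 1` (i) some later coupling `β > β₁` realises the level,
`n · a(β) = s`, with the box `L = 8n` admissible (`8n · a(β) ≤ ℓ₁`), and (ii) `γ(s) ≤ n¹² |κ₃(L, β, n)|` at every admissible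
`(L, β)` on that level.  Uniform in `n → ∞` at fixed physical geometry — the femto continuum content of the crux. -/
theorem chain_lower_of_continuous (r : LatticeRep G) {a : ℝ → ℝ} (hS : SkewnessPackage r a) (ha : ∀ β, 0 < a β)
    (ha0 : Tendsto a atTop (𝓝 0)) (hcont : Continuous a) :
    ∃ β₁ ℓ₁ ℓ : ℝ, 0 < ℓ ∧ 8 * ℓ ≤ ℓ₁ ∧ ∀ s : ℝ, 0 < s → s ≤ ℓ → ∃ γ : ℝ, 0 < γ ∧ ∀ n : ℕ, 1 ≤ n →
      (∃ β : ℝ, β₁ < β ∧ (n : ℝ) * a β = s ∧ ((8 * n : ℕ) : ℝ) * a β ≤ ℓ₁) ∧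
      ∀ (L : ℕ) [NeZero L] (β : ℝ), β₁ ≤ β → (L : ℝ) * a β ≤ ℓ₁ → 8 * n ≤ L → (n : ℝ) * a β = s →
        γ ≤ (n : ℝ) ^ 12 * |kappa3 r L β n| := by
  obtain ⟨Γ₃, β₁, ℓ₁, c₃, hℓ₁, hc₃, hΓ₃, hb⟩ := hS
  refine ⟨β₁, ℓ₁, min (ℓ₁ / 8) (a β₁ / 2), lt_min (by linarith) (by linarith [ha β₁]),
    by linarith [min_le_left (ℓ₁ / 8) (a β₁ / 2)], fun s hs hsℓ => ?_⟩
  have hs8 : 8 * s ≤ ℓ₁ := by linarith [min_le_left (ℓ₁ / 8) (a β₁ / 2)]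
  have hsa : s < a β₁ := by linarith [min_le_right (ℓ₁ / 8) (a β₁ / 2), ha β₁]
  refine ⟨c₃ * Γ₃ s, mul_pos hc₃ (hΓ₃ s hs (by linarith)), fun n hn => ⟨?_, fun L _ β hβ hL h8 hns => ?_⟩⟩
  · have hn0 : (0 : ℝ) < n := by exact_mod_cast hn
    have hlt : s / n < a β₁ := by
      calc s / n ≤ s := div_le_self hs.le (by exact_mod_cast hn)
        _ < a β₁ := hsa
    obtain ⟨β, hβ, hβs⟩ := exists_later_level' hcont ha0 β₁ (div_pos hs hn0) hlt
    have hns : (n : ℝ) * a β = s := by rw [hβs]; field_simp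
    exact ⟨β, hβ, hns, by push_cast; nlinarith [hns, hs8]⟩
  · have key := hb L β hβ hL n hn h8
    rwa [hns] at key

end Chain

/-! ## §3 The shield and the two kill criteria -/

/-- **The shield.**  Any refutation of the crux produces `(G, r, a₀)` with `G` compact simple, `a₀` CONTINUOUS and
`TwoPointPackage r a₀` — an instance of the open crux `FemtoCurvatureTwoPointC` at `(G, r)` — together with the failure of the
skewness package for EVERY continuous package map of that `(G, r)`. -/
theorem refutationC_needs_twoPointC_witness (h : ¬ FemtoCurvatureSkewnessC) :
    ∃ (G : Type) (_ : Group G) (_ : TopologicalSpace G) (_ : IsTopologicalGroup G)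
      (_ : CompactSpace G) (_ : IsCompactSimpleLieGroup G),
      letI : MeasurableSpace G := borel G
      haveI : BorelSpace G := ⟨rfl⟩
      ∃ (r : LatticeRep G) (a₀ : ℝ → ℝ), Continuous a₀ ∧ TwoPointPackage r a₀ ∧
        ∀ a : ℝ → ℝ, Continuous a → TwoPointPackage r a → ¬ SkewnessPackage r a := by
  by_contra hno
  apply h
  intro G _ _ _ _ hG
  letI : MeasurableSpace G := borel G
  haveI : BorelSpace G := ⟨rfl⟩
  intro r hex
  obtain ⟨a₀, ha₀, h₀⟩ := hex
  by_contra hS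
  exact hno ⟨G, _, _, _, _, hG, r, a₀, ha₀, h₀, fun a ha hP hSk => hS ⟨a, ha, hP, hSk⟩⟩

/-- **Kill criterion I (a-free: one torus, zeros at arbitrarily large coupling).**  A continuous two-point witness plus ONE torus
`L ≥ 8n` on which `β ↦ κ₃(L, β, n)` vanishes frequently as `β → ∞` refutes the crux: whatever continuous map the crux answers with,
its windows contain a neighbourhood of `+∞` on every fixed torus. -/
theorem not_cruxC_of_frequently_zero
    (h : ∃ (G : Type) (_ : Group G) (_ : TopologicalSpace G) (_ : IsTopologicalGroup G)
      (_ : CompactSpace G) (_ : IsCompactSimpleLieGroup G),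
      letI : MeasurableSpace G := borel G
      haveI : BorelSpace G := ⟨rfl⟩
      ∃ (r : LatticeRep G) (a₀ : ℝ → ℝ), Continuous a₀ ∧ TwoPointPackage r a₀ ∧
        ∃ (L : ℕ) (_ : NeZero L) (n : ℕ), 1 ≤ n ∧ 8 * n ≤ L ∧ ∃ᶠ β in atTop, kappa3 r L β n = 0) :
    ¬ FemtoCurvatureSkewnessC := by
  intro hcrux
  obtain ⟨G, _, _, _, _, hG, r, a₀, ha₀, h₀, L, _, n, hn, h8, hfreq⟩ := h
  letI : MeasurableSpace G := borel G
  haveI : BorelSpace G := ⟨rfl⟩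
  exact hfreq (eventual_of_cruxC hcrux G hG r ⟨a₀, ha₀, h₀⟩ L n hn h8)

/-- **Kill criterion II (the exact exposure of R1∘C′): zeros in physically shrinking boxes.**  A continuous two-point witness `a₀`
for `(G, r)` together with exact zeros of the cumulant above every coupling `b` and inside boxes of ARBITRARILY SMALL physical size in
the ruler `a₀` (`L · a₀(β) ≤ ε`) refutes the crux: by ruler rigidity (`rulerRigidity_continuous`, landed) the continuous package map
`a` returned by the crux satisfies `a ≤ K · a₀` eventually, so such zeros are admissible for its skewness window whatever `β₁, ℓ₁`
are — and an admissible exact zero contradicts `c₃ Γ₃ > 0`. -/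
theorem not_cruxC_of_zeros_in_shrinking_boxes
    (h : ∃ (G : Type) (_ : Group G) (_ : TopologicalSpace G) (_ : IsTopologicalGroup G)
      (_ : CompactSpace G) (_ : IsCompactSimpleLieGroup G),
      letI : MeasurableSpace G := borel G
      haveI : BorelSpace G := ⟨rfl⟩
      ∃ (r : LatticeRep G) (a₀ : ℝ → ℝ), Continuous a₀ ∧ TwoPointPackage r a₀ ∧
        ∀ ε b : ℝ, 0 < ε → ∃ (L : ℕ) (_ : NeZero L) (β : ℝ) (n : ℕ),
          b ≤ β ∧ (L : ℝ) * a₀ β ≤ ε ∧ 1 ≤ n ∧ 8 * n ≤ L ∧ kappa3 r L β n = 0) :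
    ¬ FemtoCurvatureSkewnessC := by
  intro hcrux
  obtain ⟨G, _, _, _, _, hG, r, a₀, ha₀, h₀, hzero⟩ := h
  letI : MeasurableSpace G := borel G
  haveI : BorelSpace G := ⟨rfl⟩
  obtain ⟨a, ha, hP, hS⟩ := hcrux G hG r ⟨a₀, ha₀, h₀⟩
  obtain ⟨Γ₀, β₀, ℓ₀, c, C, h₁⟩ := h₀
  obtain ⟨Γ, β₀', ℓ₀', c', C', h₂⟩ := hP
  have hapos : ∀ β, 0 < a β := h₂.2.2.1
  obtain ⟨K, β₃, hK, hKβ⟩ :=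
    rulerRigidity_continuous G r a₀ a Γ₀ Γ β₀ ℓ₀ c C β₀' ℓ₀' c' C' h₁ h₂ ha₀ ha
  have hS' : SkewnessPackage r a := hS
  obtain ⟨Γ₃, β₁, ℓ₁, c₃, hℓ₁, hc₃, hΓ₃, hb⟩ := hS'
  obtain ⟨L, _, β, n, hβ, hLε, hn, h8, hz⟩ := hzero (ℓ₁ / K) (max β₁ β₃) (div_pos hℓ₁ hK)
  have hLa : (L : ℝ) * a β ≤ ℓ₁ := by
    have h1 : a β ≤ K * a₀ β := (hKβ β (le_of_max_le_right hβ)).1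
    calc (L : ℝ) * a β ≤ (L : ℝ) * (K * a₀ β) := mul_le_mul_of_nonneg_left h1 (Nat.cast_nonneg L)
      _ = K * ((L : ℝ) * a₀ β) := by ring
      _ ≤ K * (ℓ₁ / K) := mul_le_mul_of_nonneg_left hLε hK.le
      _ = ℓ₁ := mul_div_cancel₀ _ hK.ne'
  have key := hb L β (le_of_max_le_left hβ) hLa n hn h8
  rw [hz, abs_zero, mul_zero] at key
  obtain ⟨hs, hsℓ⟩ := level_mem_window hapos hLa hn h8
  exact absurd key (not_le.2 (mul_pos hc₃ (hΓ₃ _ hs hsℓ)))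

end Summit.QuantumFields.YangMills.Theorems.FemtoCurvatureSkewnessC.Negative
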